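import Summits.CriticalPhenomena.PercolationContinuityZ3.Theorems.Transplant.PlanarSkeletonFrmScaledRays
import HarnessLib

/-!
# Scaled Φ2 port, XII′: the CORNER ESCAPE of a ray top by `N`-steps — from the top of a column (just outside `Λ_ℓ` in direction `eᵢ`) to the
# corner region `[ℓ+W+1, ℓ+W+N]²`, staying outside `Λ_ℓ` (the two halves of the run of the scaled kit; SCALED-PHI2-PORT "design correction")

builds on p205010 (kernel theorem, internal audit signed; external expert review pending) — nothing in this file uses p205010; nothing here is a
claim about the open node `SamePDropOfSkeletonFrmScaled₁`.  Lane `prim-bschramm`, seat `prim-bschramm-p4` gen 16 (PART C3 of `P4-GENERAL.md` §38.5).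
Helper file (`--supports stmt-CriticalPhenomena-4575 --as helper`).  No probability.

WHY A CORNER AND NOT A COMMON POSITION (XII used the NE corner position `(ℓ+2, ℓ+2)` reached EXACTLY by unit steps): with `N`-steps only the coset
`φ x + Nℤ²` is reachable from the column of `x`, and `φ x − φ y` is in general not `≡ 0 (mod N)`; so the two halves of the run are only brought to
WITHIN `N` of each other in the chart (both ends in the box `[ℓ+W+1, ℓ+W+N]²` of side `N`), and the run is closed by a bounded walk inside the
width-`W` cylinder around one end (`PlanarSkeletonFrmScaled.exists_adjust_bound'`, (κ′) transported by frames), which avoids `Λ_ℓ` because every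
point of that cylinder has both offsets `≥ ℓ + 1`.
* `exists_axis_escape` — `k` steps of `+N eᵢ` from a vertex with `i`-offset `o`, reaching the FIRST offset `≥ T` (so `≤ T + N − 1`), positions exact;
* **`exists_corner_escape`** — from a column top `p` (`ℓ < φᵢ p − φᵢ t ≤ ℓ + N`, `|φⱼ p − φⱼ t| ≤ ℓ`, `j ≠ i`): a walk of length `≤ 2ℓ + 2W + 2N + 2`
  to a vertex `u` with BOTH offsets in `[ℓ + W + 1, ℓ + W + N]`, every vertex of which has `i`-offset in `(ℓ, ℓ+W+N]` and `j`-offset in `[−ℓ, ℓ+W+N]`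
  (so it lies outside `Λ_ℓ(t)` and inside `Λ_{ℓ+W+N}(t)`).
[cite: KozmaNitzan2024, §4 p. 26 ((29))] [cite: AizenmanGrimmett1991, Thm 1 (essential enhancements)]
-/

noncomputable section

namespace Summit.CriticalPhenomena.PercolationContinuityZ3.Theorems.Transplant

namespace PlanarSkeletonFrmScaled

open SimpleGraph Walk Literature.Probability.LatticeModels
open scoped Classical

-- the scaled skeleton is called `Ψ` in this file
variable {V : Type} {G : SimpleGraph V} [G.LocallyFinite] (Ψ : PlanarSkeletonFrmScaled G)

/-- **Axis escape**: from `v`, stepping `+N eᵢ` until the `i`-offset (relative to `t`) first reaches `≥ T`: a walk of length `k ≤ (T − o)⁺ + 1`-ish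
(precisely `k = ⌈(T − o)⁺ / N⌉`, we only record `k ≤ (T − o).toNat + 1`), end offset in `[T, T + N − 1] ∪ {o}` (if already `o ≥ T` then `k = 0`),
all vertices with `i`-offset in `[o, max o (T + N − 1)]` and the other coordinate unchanged. [folklore] -/
theorem exists_axis_escape (t v : V) (i : Fin 2) (T : ℤ) :
    ∃ u, ∃ P : G.Walk v u, (P.length : ℤ) ≤ (T - (Ψ.φ v i - Ψ.φ t i)).toNat + 1 ∧
      T ≤ max (Ψ.φ u i - Ψ.φ t i) (Ψ.φ v i - Ψ.φ t i) ∧ Ψ.φ u i - Ψ.φ t i ≤ max (T + Ψ.N - 1) (Ψ.φ v i - Ψ.φ t i) ∧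
      (∀ j : Fin 2, j ≠ i → Ψ.φ u j = Ψ.φ v j) ∧
      ∀ z ∈ P.support, Ψ.φ v i - Ψ.φ t i ≤ Ψ.φ z i - Ψ.φ t i ∧ Ψ.φ z i - Ψ.φ t i ≤ max (T + Ψ.N - 1) (Ψ.φ v i - Ψ.φ t i) ∧
        ∀ j : Fin 2, j ≠ i → Ψ.φ z j = Ψ.φ v j := by
  have hN1 : 1 ≤ Ψ.N := Ψ.one_le_N
  set o : ℤ := Ψ.φ v i - Ψ.φ t i with ho
  -- number of steps: the least `k` with `o + k N ≥ T`
  set a : ℕ := (T - o).toNat with ha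
  -- number of steps: the least `k` with `k N ≥ a`
  have hex : ∃ k : ℕ, a ≤ k * Ψ.N := ⟨a, by nlinarith⟩
  set k : ℕ := Nat.find hex with hk
  have hk1 : a ≤ k * Ψ.N := Nat.find_spec hex
  have hk2 : k * Ψ.N ≤ a + Ψ.N - 1 := by
    rcases Nat.eq_zero_or_pos k with h0 | hpos
    · rw [h0]; omega
    · have hmin : ¬ a ≤ (k - 1) * Ψ.N := Nat.find_min hex (show k - 1 < Nat.find hex by rw [← hk]; omega)
      have e : (k - 1) * Ψ.N + Ψ.N = k * Ψ.N := by
        rw [← Nat.succ_mul]; congr 1; omega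
      omega
  have hk3 : k ≤ a := Nat.find_min' hex (show a ≤ a * Ψ.N by nlinarith)
  obtain ⟨u, P, hlen, hφu, hsup⟩ := Ψ.exists_ray v i 1 k
  refine ⟨u, P, ?_, ?_, ?_, fun j hj => ?_, fun z hz => ?_⟩
  · rw [hlen]; exact_mod_cast Nat.le_succ_of_le hk3
  · have hu : Ψ.φ u i - Ψ.φ t i = o + k * Ψ.N := by
      rw [hφu, Pi.add_apply, Pi.single_eq_same, Units.val_one, mul_one, ho]; ring
    rw [hu]
    have hk1' : (a : ℤ) ≤ (k * Ψ.N : ℕ) := by exact_mod_cast hk1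
    push_cast at hk1'
    rcases le_or_gt T o with hTo | hTo
    · exact le_max_of_le_right hTo
    · have : (a : ℤ) = T - o := by rw [ha, Int.toNat_of_nonneg (by omega)]
      exact le_max_of_le_left (by linarith)
  · have hu : Ψ.φ u i - Ψ.φ t i = o + k * Ψ.N := by
      rw [hφu, Pi.add_apply, Pi.single_eq_same, Units.val_one, mul_one, ho]; ring
    rw [hu]
    have hk2' : ((k * Ψ.N : ℕ) : ℤ) ≤ ((a + Ψ.N - 1 : ℕ) : ℤ) := by exact_mod_cast hk2
    rcases le_or_gt T o with hTo | hTo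
    · have ha0 : a = 0 := by rw [ha]; exact Int.toNat_of_nonpos (by omega)
      have hk0 : k = 0 := by omega
      rw [hk0]; simp
    · have haT : (a : ℤ) = T - o := by rw [ha, Int.toNat_of_nonneg (by omega)]
      have : ((a + Ψ.N - 1 : ℕ) : ℤ) = (a : ℤ) + Ψ.N - 1 := by
        rw [Nat.add_sub_assoc hN1]; push_cast; rw [Nat.cast_sub hN1]; push_cast; ring
      push_cast at hk2'
      rw [this] at hk2'
      exact le_max_of_le_left (by linarith)
  · rw [hφu, Pi.add_apply, Pi.single_eq_of_ne hj, add_zero]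
  · obtain ⟨m, hm, hφz⟩ := hsup z hz
    refine ⟨?_, ?_, fun j hj => by rw [hφz, Pi.add_apply, Pi.single_eq_of_ne hj, add_zero]⟩
    · rw [hφz, Pi.add_apply, Pi.single_eq_same, Units.val_one, mul_one, ho]
      have : (0 : ℤ) ≤ (m : ℤ) * Ψ.N := by positivity
      linarith
    · rw [hφz, Pi.add_apply, Pi.single_eq_same, Units.val_one, mul_one]
      have hmk : m * Ψ.N ≤ k * Ψ.N := Nat.mul_le_mul_right _ hm
      rcases le_or_gt T o with hTo | hTo
      · have ha0 : a = 0 := by rw [ha]; exact Int.toNat_of_nonpos (by omega)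
        have hk0 : k = 0 := by omega
        have hm0 : m = 0 := by omega
        rw [hm0]; simp [ho]
      · have haT : (a : ℤ) = T - o := by rw [ha, Int.toNat_of_nonneg (by omega)]
        have hk2' : ((k * Ψ.N : ℕ) : ℤ) ≤ ((a + Ψ.N - 1 : ℕ) : ℤ) := by exact_mod_cast hk2
        have e : ((a + Ψ.N - 1 : ℕ) : ℤ) = (a : ℤ) + Ψ.N - 1 := by
          rw [Nat.add_sub_assoc hN1]; push_cast; rw [Nat.cast_sub hN1]; push_cast; ring
        have hmk' : ((m * Ψ.N : ℕ) : ℤ) ≤ ((k * Ψ.N : ℕ) : ℤ) := by exact_mod_cast hmk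
        push_cast at hk2' hmk'
        rw [e] at hk2'
        refine le_max_of_le_left ?_
        rw [ho] at haT
        linarith

/-- **THE CORNER ESCAPE of a column top**: from `p` with `ℓ < φᵢ p − φᵢ t ≤ ℓ + N` and `|φⱼ p − φⱼ t| ≤ ℓ` (`j ≠ i`), a walk of length
`≤ 2ℓ + 2W + 2N + 4` to a vertex whose two offsets lie in `[ℓ + W + 1, ℓ + W + N]`, all of whose vertices have `i`-offset in `(ℓ, ℓ+W+N]` and
`j`-offset in `[−ℓ, ℓ+W+N]` — outside `Λ_ℓ(t)`, inside `Λ_{ℓ+W+N}(t)`. [cite: KozmaNitzan2024, §4 p. 26 ((29))] -/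
theorem exists_corner_escape (t p : V) (i j : Fin 2) (hij : j ≠ i) (ℓ W : ℕ)
    (hpi : (ℓ : ℤ) < Ψ.φ p i - Ψ.φ t i ∧ Ψ.φ p i - Ψ.φ t i ≤ ℓ + Ψ.N) (hpj : |Ψ.φ p j - Ψ.φ t j| ≤ ℓ) :
    ∃ u, ∃ P : G.Walk p u, (P.length : ℤ) ≤ 2 * ℓ + 2 * W + 2 * Ψ.N + 4 ∧
      ((ℓ : ℤ) + W + 1 ≤ Ψ.φ u i - Ψ.φ t i ∧ Ψ.φ u i - Ψ.φ t i ≤ ℓ + W + Ψ.N) ∧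
      ((ℓ : ℤ) + W + 1 ≤ Ψ.φ u j - Ψ.φ t j ∧ Ψ.φ u j - Ψ.φ t j ≤ ℓ + W + Ψ.N) ∧
      ∀ z ∈ P.support, ((ℓ : ℤ) < Ψ.φ z i - Ψ.φ t i ∧ Ψ.φ z i - Ψ.φ t i ≤ ℓ + W + Ψ.N) ∧
        (-(ℓ : ℤ) ≤ Ψ.φ z j - Ψ.φ t j ∧ Ψ.φ z j - Ψ.φ t j ≤ ℓ + W + Ψ.N) := by
  have hN1 : 1 ≤ Ψ.N := Ψ.one_le_N
  have hij' : i ≠ j := fun h => hij h.symm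
  rw [abs_le] at hpj
  -- leg 1: direction `i` up to offset `ℓ + W + 1`
  obtain ⟨q, P₁, hlen₁, hq1, hq2, hqj, hsup₁⟩ := Ψ.exists_axis_escape t p i ((ℓ : ℤ) + W + 1)
  have hqi : (ℓ : ℤ) + W + 1 ≤ Ψ.φ q i - Ψ.φ t i ∧ Ψ.φ q i - Ψ.φ t i ≤ ℓ + W + Ψ.N := by
    constructor
    · rcases le_max_iff.1 hq1 with h | h
      · exact h
      · have := (hsup₁ q P₁.end_mem_support).1; linarith
    · rcases max_cases ((ℓ : ℤ) + W + 1 + Ψ.N - 1) (Ψ.φ p i - Ψ.φ t i) with ⟨h, -⟩ | ⟨h, -⟩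
      · rw [h] at hq2; linarith
      · rw [h] at hq2; linarith [hpi.2]
  have hqj' : Ψ.φ q j = Ψ.φ p j := hqj j hij
  -- leg 2: direction `j` up to offset `ℓ + W + 1`
  obtain ⟨u, P₂, hlen₂, hu1, hu2, huj, hsup₂⟩ := Ψ.exists_axis_escape t q j ((ℓ : ℤ) + W + 1)
  have hui' : Ψ.φ u i = Ψ.φ q i := huj i hij'
  refine ⟨u, P₁.append P₂, ?_, ?_, ?_, fun z hz => ?_⟩
  · rw [Walk.length_append]; push_cast
    have h1 : ((ℓ : ℤ) + W + 1 - (Ψ.φ p i - Ψ.φ t i)).toNat ≤ W + 1 :=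
      Int.toNat_le.2 (by push_cast; linarith [hpi.1])
    have h2 : ((ℓ : ℤ) + W + 1 - (Ψ.φ q j - Ψ.φ t j)).toNat ≤ 2 * ℓ + W + 1 :=
      Int.toNat_le.2 (by rw [hqj']; push_cast; linarith [hpj.1])
    have h1' : ((((ℓ : ℤ) + W + 1 - (Ψ.φ p i - Ψ.φ t i)).toNat : ℕ) : ℤ) ≤ W + 1 := by exact_mod_cast h1
    have h2' : ((((ℓ : ℤ) + W + 1 - (Ψ.φ q j - Ψ.φ t j)).toNat : ℕ) : ℤ) ≤ 2 * ℓ + W + 1 := by exact_mod_cast h2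
    linarith
  · rw [hui']; exact hqi
  · constructor
    · rcases le_max_iff.1 hu1 with h | h
      · exact h
      · -- `q`'s `j`-offset is `p`'s, at most `ℓ`; so the max is the first argument unless no step was needed — impossible here
        rw [hqj'] at h; linarith
    · rcases max_cases ((ℓ : ℤ) + W + 1 + Ψ.N - 1) (Ψ.φ q j - Ψ.φ t j) with ⟨h, -⟩ | ⟨h, hlt⟩
      · rw [h] at hu2; linarith
      · rw [hqj'] at hlt; linarith [show (0 : ℤ) ≤ Ψ.N by positivity]
  · rw [Walk.mem_support_append_iff] at hz
    rcases hz with hz | hz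
    · obtain ⟨hz1, hz2, hzj⟩ := hsup₁ z hz
      have hzj' := hzj j hij
      refine ⟨⟨by linarith [hpi.1], ?_⟩, ⟨by rw [hzj']; exact hpj.1, by rw [hzj']; linarith [hpj.2]⟩⟩
      rcases max_cases ((ℓ : ℤ) + W + 1 + Ψ.N - 1) (Ψ.φ p i - Ψ.φ t i) with ⟨h, -⟩ | ⟨h, -⟩
      · rw [h] at hz2; linarith
      · rw [h] at hz2; linarith [hpi.2]
    · obtain ⟨hz1, hz2, hzj⟩ := hsup₂ z hz
      have hzi' : Ψ.φ z i = Ψ.φ q i := hzj i hij'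
      refine ⟨⟨by rw [hzi']; linarith [hqi.1], by rw [hzi']; exact hqi.2⟩, ⟨by rw [hqj'] at hz1; linarith [hpj.1], ?_⟩⟩
      rcases max_cases ((ℓ : ℤ) + W + 1 + Ψ.N - 1) (Ψ.φ q j - Ψ.φ t j) with ⟨h, -⟩ | ⟨h, -⟩
      · rw [h] at hz2; linarith
      · rw [h] at hz2; rw [hqj'] at hz2; linarith [hpj.2]

end PlanarSkeletonFrmScaled

end Summit.CriticalPhenomena.PercolationContinuityZ3.Theorems.Transplant

end
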